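import Summits.CriticalPhenomena.PercolationContinuityZ3.Theorems.Transplant.KNCells2Corridor
import HarnessLib

/-!
# F8 (generic, LAG-1 ANCHORS) — the corridor input from a chain of target steps IN ANOTHER GRAPH STRUCTURE on the same vertices
# (for `X □ ℤ²`: the chain runs in p3-g2's TUBE GRAPH `tubeGraph X π`, whose levels have macro contacts only; design F8-DESIGN.md §7)

builds on p205010 (kernel theorem, internal audit signed; external expert review pending) — nothing in this file uses p205010.
Lane `prim-bschramm`, seat `prim-bschramm-p2` (Corridor-over-levels); helper file (`--supports stmt-CriticalPhenomena-4575`).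

`hreach_of_chain` (KNCells2Corridor) takes the `TStep`s over the ambient graph `G`.  The events of a chain (`o ↔ B`, `o ↔ T`) are events of
the CONFIGURATION, so the chain may be organised by any locally finite graph structure `G'` on `V` for which the instance can prove the
kits (`TargetProperty G' Δ' p`, `TStep G'`, `KitsAt` under the same weighting `Wcor`): **`hreach_of_chain'`**.
[cite: KozmaNitzan2024, §4 Lemma 12 (pp. 23–25), p. 30 (Step IV) — the ℤ^d model] [cite: GrimmettPercolation1999, §7.2]
-/

noncomputable section

open MeasureTheory ProbabilityTheory
open scoped ENNReal Classical

namespace Summit.CriticalPhenomena.PercolationContinuityZ3.Theorems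

namespace Transplant

namespace KNCells

open Literature.Probability.Percolation Literature.Probability.LatticeModels SimpleGraph GadgetSystem ProbeHistory HSiteScheme Contour

variable {V : Type*} [DecidableEq V] [Countable V]

namespace KSchA

variable {A : Type*} {G : SimpleGraph V} [G.LocallyFinite] {S : KSchA V A} {FD : FaceData V A}
variable {h : ProbeHistory V} {e : Site 2 × MDir} {a' : A} {du : MDir}

/-- **LEMMA 12 OVER CELLS ⟹ `hreach`, chain in an auxiliary graph structure `G'`.**  As `hreach_of_chain`, with the target steps, their
kits and the chain property (`TargetProperty.chain` for `G'`) formulated over any locally finite `G'` on the same vertex type.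
[cite: KozmaNitzan2024, §4 Lemma 12 (pp. 23–25), p. 30 (Step IV)] -/
theorem hreach_of_chain' (G' : SimpleGraph V) [G'.LocallyFinite] (hV : S.Valid₂ G h e) {Δ' : ℕ} {δ ε'' : ℝ} {n : ℕ} (hδc : S.δc ≤ δ)
    (hchain : ∀ (W : Sym2 V → unitInterval) (s : Fin (n + 1) → KNLevels.TStep G'),
      (∀ i : Fin (n + 1), (s i).L.o = (s 0).L.o) →
      (∀ i : Fin n, (s (Fin.castSucc i)).T ⊆ (s i.succ).L.X 0) →
      (∀ i : Fin (n + 1), (s i).KitsAt W S.p Δ' δ) →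
      1 - δ < (prodBernoulli W).real (s 0).L.reachB →
        1 - ε'' < (prodBernoulli W).real (⋃ t ∈ (s (Fin.last n)).T, openConn (s 0).L.o t))
    (s : Fin (n + 1) → KNLevels.TStep G') (ho : ∀ i : Fin (n + 1), (s i).L.o = S.Γ.root)
    (hlink : ∀ i : Fin n, (s (Fin.castSucc i)).T ⊆ (s i.succ).L.X 0)
    (hkits : ∀ i : Fin (n + 1), (s i).KitsAt (S.Wcor G FD h e (S.aOf₁ G h e) a' du) S.p Δ' δ)
    (hB0 : S.Γ.M (S.aOf₁ G h e) (tgt e) ⊆ (s 0).L.X 0) (hTn : (s (Fin.last n)).T = S.Γ.M a' (tgt e + stepVec du)) :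
    1 - ε'' < (prodBernoulli (S.Wfull G h e (S.aOf₁ G h e) a' du)).real (S.Reach G FD h e (S.aOf₁ G h e) a' du) := by
  set α := S.aOf₁ G h e with hα
  have hroot : S.Γ.root ∈ S.Ucor G FD h e α a' du := Finset.mem_union_left _ (Finset.mem_union_left _ hV.root_mem)
  have ho' : ∀ i : Fin (n + 1), (s i).L.o = (s 0).L.o := fun i => by rw [ho i, ho 0]
  have hsrc : 1 - δ < (prodBernoulli (S.Wcor G FD h e α a' du)).real (s 0).L.reachB := by
    have := lt_real_reachB_Wcor hV hroot hB0 (a' := a') (du := du)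
    rw [KNLevels.LData.reachB, ho 0]
    linarith
  have hc := hchain _ s ho' hlink hkits hsrc
  rw [hTn, ho 0, Wcor, ← Finset.set_biUnion_coe, prodBernoulli_restrW_real_biUnion_openConn _ _ (Finset.mem_coe.2 hroot)] at hc
  exact hc

end KSchA

end KNCells

end Transplant

end Summit.CriticalPhenomena.PercolationContinuityZ3.Theorems

end
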